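import Summits.QuantumFields.YangMills.Theorems.ColdStartUniversalityLatticeLangevinWilsonGapUpperBound
import Summits.QuantumFields.YangMills.Theorems.ColdStartUniversalityUniformColdStartMixingChiSquareStep
import HarnessLib

/-!
# Route `ColdStartUniversality`, aside K_A1 `UniformColdStartMixing` (24809) — the fixed-cut-off rung of (H1) WITH ITS CONSTANT:
# at cut-off `K` the physical `L²` rate is `c_K = (3/2)·e^{−4β'_K·#𝒫_K}/ε_K` (and at most `3/(2ε_K)`)

Helper file (seat `ym-line-csu-p1`, g19; `--supports stmt-QuantumFields-24809`).  g16's rung `uniformL2Gap_fixedCutoff` says: at each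
cut-off `K` the hypothesis (H1) of `chiSquareStep` (an `L²(μ_K)` decay rate in PHYSICAL units for all bounded measurable observables and
every realising kernel family) holds with SOME `c > 0`.  With the explicit package of g19 (`wilson_spectralGap_explicit_measurable`,
`decayRate_le_three_halves`) the constant is now a number:

* ★ `uniformL2Gap_fixedCutoff_explicit` — (H1) at cut-off `K` with `c_K := (3/2)·exp(−|β'_K|·4·#𝒫_K)/ε_K`, `β'_K = (γε_K)⁻¹/2`,
  `#𝒫_K = 3·L_K³`, `L_K = (F.P K).sitesPerDir 0`: `∫ (κ_tG − μ_KG)² dμ_K ≤ exp(−2c_K·ε_K t)·Var_{μ_K}(G)`;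
* ★ `physicalL2Rate_le_fixedCutoff` — conversely (`L_K ≥ 2`), NO physical rate `c` valid for all continuous observables at cut-off `K`
  exceeds `3/(2ε_K)` (gauge modes).

PLANNER-FACING, HONEST: `c_K ~ ε_K⁻¹ exp(−6L_K³/(γε_K)) → 0` super-exponentially — the generic (Holley–Stroock) fixed-cut-off constant
is hopeless for (H1), whose content is precisely a K-UNIFORM `c`; nothing here is uniform in the cut-off.  RECORD-rung R3 plumbing; no
rung of the ladder, crux or summit statement is proved; the Yang–Mills mass gap is NOT proved.
-/

set_option autoImplicit false

noncomputable section

namespace Summit.QuantumFields.YangMills.Theorems.ColdStartUniversality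

open MeasureTheory ProbabilityTheory
open scoped NNReal ENNReal
open Literature.Probability.Process Literature.MathematicalPhysics.QuantumFieldTheory
open Literature.MathematicalPhysics.QuantumLattice (fundamentalRep fundamentalLatticeRep continuous_fundamentalRep)
open Literature.MathematicalPhysics.QuantumFieldTheory.Balaban1983to89

/-- ★ **The fixed-cut-off rung of (H1) with an explicit constant.**  At cut-off `K` (lattice `L_K = (F.P K).sitesPerDir 0`, coupling
`β'_K = (γε_K)⁻¹/2`), for every realising kernel family, every measurable `G` with `|G| ≤ 1` and every lattice time `t`:
`∫ (κ_tG − μ_KG)² dμ_K ≤ exp(−2·c_K·(ε_K t))·Var_{μ_K}(G)` with the EXPLICIT physical rate `c_K = (3/2)e^{−4|β'_K|#𝒫_K}/ε_K`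
(g16's `uniformL2Gap_fixedCutoff` had `∃ c > 0`). [cite: HolleyStroock1987] [cite: BakryGentilLedoux2014, Thm 4.2.5] -/
theorem uniformL2Gap_fixedCutoff_explicit (F : T3ContinuumYM3Torus.T3Family) (γ : ℝ) (K : ℕ)
    (κ : ℝ≥0 → Kernel (GaugeConfig 3 ((F.P K).sitesPerDir 0) (Matrix.specialUnitaryGroup (Fin 2) ℂ))
      (GaugeConfig 3 ((F.P K).sitesPerDir 0) (Matrix.specialUnitaryGroup (Fin 2) ℂ))) [∀ t, IsMarkovKernel (κ t)]
    (hreal : ∀ (t : ℝ≥0) (x : GaugeConfig 3 ((F.P K).sitesPerDir 0) (Matrix.specialUnitaryGroup (Fin 2) ℂ))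
      (Ω : Type) [MeasurableSpace Ω] (P : Measure Ω) [IsProbabilityMeasure P]
      (W : ℝ≥0 → Ω → (Edge 3 ((F.P K).sitesPerDir 0) × NoiseIdx 2 → ℝ)) (hW : IsFlatBrownian W P)
      (U : ℝ≥0 → Ω → GaugeConfig 3 ((F.P K).sitesPerDir 0) (Matrix.specialUnitaryGroup (Fin 2) ℂ)),
      (∀ ω, U 0 ω = x) →
      (latticeLangevinDynamics (fundamentalLatticeRep 2) ((γ * (F.P K).eps)⁻¹ / 2)).IsSolution (fundamentalRep (Fin 2))
        hW.natFiltration P W U →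
      κ t x = P.map (U t))
    {G : GaugeConfig 3 ((F.P K).sitesPerDir 0) (Matrix.specialUnitaryGroup (Fin 2) ℂ) → ℝ} (hG : Measurable G)
    (hG1 : ∀ x, |G x| ≤ 1) (t : ℝ≥0) :
    ∫ x, ((∫ y, G y ∂(κ t x)) - ∫ z, G z ∂(wilsonMeasure (d := 3) (L := (F.P K).sitesPerDir 0)
        (fundamentalRep (Fin 2)) ((γ * (F.P K).eps)⁻¹ / 2))) ^ 2
        ∂(wilsonMeasure (d := 3) (L := (F.P K).sitesPerDir 0) (fundamentalRep (Fin 2)) ((γ * (F.P K).eps)⁻¹ / 2)) ≤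
      Real.exp (-2 * ((3 / 2 : ℝ) * Real.exp (-(|(γ * (F.P K).eps)⁻¹ / 2| *
          (4 * (Fintype.card (Plaquette 3 ((F.P K).sitesPerDir 0)) : ℝ)))) / (F.P K).eps) * ((F.P K).eps * t)) *
        ∫ x, (G x - ∫ z, G z ∂(wilsonMeasure (d := 3) (L := (F.P K).sitesPerDir 0)
          (fundamentalRep (Fin 2)) ((γ * (F.P K).eps)⁻¹ / 2))) ^ 2
          ∂(wilsonMeasure (d := 3) (L := (F.P K).sitesPerDir 0) (fundamentalRep (Fin 2)) ((γ * (F.P K).eps)⁻¹ / 2)) := by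
  have hε : 0 < (F.P K).eps := (F.P K).eps_pos
  have h := wilson_spectralGap_explicit_measurable ((F.P K).sitesPerDir 0) ((γ * (F.P K).eps)⁻¹ / 2) κ hreal hG hG1 t
  have e : -2 * ((3 / 2 : ℝ) * Real.exp (-(|(γ * (F.P K).eps)⁻¹ / 2| *
      (4 * (Fintype.card (Plaquette 3 ((F.P K).sitesPerDir 0)) : ℝ)))) / (F.P K).eps) * ((F.P K).eps * (t : ℝ)) =
      -2 * ((3 / 2 : ℝ) * Real.exp (-(|(γ * (F.P K).eps)⁻¹ / 2| *
      (4 * (Fintype.card (Plaquette 3 ((F.P K).sitesPerDir 0)) : ℝ))))) * t := by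
    field_simp
  rw [e]
  exact h

/-- ★ **No physical `L²` rate at a fixed cut-off exceeds `3/(2ε_K)`** (`L_K ≥ 2`): if at cut-off `K` some realising kernel family
satisfies `∫ (κ_tG − μ_KG)² dμ_K ≤ exp(−2c·(ε_K t))·Var_{μ_K}(G)` for all continuous `G` and all `t`, then `c ≤ 3/(2ε_K)` — the gauge
modes of `decayRate_le_three_halves`.  (No obstruction to (H1): the bound diverges as `ε_K → 0`.) [folklore] -/
theorem physicalL2Rate_le_fixedCutoff (F : T3ContinuumYM3Torus.T3Family) (γ : ℝ) (K : ℕ) (hL : 2 ≤ (F.P K).sitesPerDir 0)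
    (κ : ℝ≥0 → Kernel (GaugeConfig 3 ((F.P K).sitesPerDir 0) (Matrix.specialUnitaryGroup (Fin 2) ℂ))
      (GaugeConfig 3 ((F.P K).sitesPerDir 0) (Matrix.specialUnitaryGroup (Fin 2) ℂ))) [∀ t, IsMarkovKernel (κ t)]
    (hreal : ∀ (t : ℝ≥0) (x : GaugeConfig 3 ((F.P K).sitesPerDir 0) (Matrix.specialUnitaryGroup (Fin 2) ℂ))
      (Ω : Type) [MeasurableSpace Ω] (P : Measure Ω) [IsProbabilityMeasure P]
      (W : ℝ≥0 → Ω → (Edge 3 ((F.P K).sitesPerDir 0) × NoiseIdx 2 → ℝ)) (hW : IsFlatBrownian W P)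
      (U : ℝ≥0 → Ω → GaugeConfig 3 ((F.P K).sitesPerDir 0) (Matrix.specialUnitaryGroup (Fin 2) ℂ)),
      (∀ ω, U 0 ω = x) →
      (latticeLangevinDynamics (fundamentalLatticeRep 2) ((γ * (F.P K).eps)⁻¹ / 2)).IsSolution (fundamentalRep (Fin 2))
        hW.natFiltration P W U →
      κ t x = P.map (U t))
    {c : ℝ}
    (hdecay : ∀ (G : GaugeConfig 3 ((F.P K).sitesPerDir 0) (Matrix.specialUnitaryGroup (Fin 2) ℂ) → ℝ), Continuous G →
      ∀ t : ℝ≥0,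
      ∫ x, ((∫ y, G y ∂(κ t x)) - ∫ z, G z ∂(wilsonMeasure (d := 3) (L := (F.P K).sitesPerDir 0)
          (fundamentalRep (Fin 2)) ((γ * (F.P K).eps)⁻¹ / 2))) ^ 2
          ∂(wilsonMeasure (d := 3) (L := (F.P K).sitesPerDir 0) (fundamentalRep (Fin 2)) ((γ * (F.P K).eps)⁻¹ / 2)) ≤
        Real.exp (-2 * c * ((F.P K).eps * t)) *
          ∫ x, (G x - ∫ z, G z ∂(wilsonMeasure (d := 3) (L := (F.P K).sitesPerDir 0)
            (fundamentalRep (Fin 2)) ((γ * (F.P K).eps)⁻¹ / 2))) ^ 2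
            ∂(wilsonMeasure (d := 3) (L := (F.P K).sitesPerDir 0) (fundamentalRep (Fin 2)) ((γ * (F.P K).eps)⁻¹ / 2))) :
    c ≤ 3 / 2 / (F.P K).eps := by
  have hε : 0 < (F.P K).eps := (F.P K).eps_pos
  have h := decayRate_le_three_halves ((F.P K).sitesPerDir 0) hL ((γ * (F.P K).eps)⁻¹ / 2) κ hreal (lam := c * (F.P K).eps)
    (fun G hG t => by
      have h1 := hdecay G hG t
      have e : -2 * c * ((F.P K).eps * (t : ℝ)) = -2 * (c * (F.P K).eps) * t := by ring
      rw [e] at h1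
      exact h1)
  rw [le_div_iff₀ hε]
  exact h

end Summit.QuantumFields.YangMills.Theorems.ColdStartUniversality

end
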